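import Summits.QuantumFields.YangMills.Theorems.ChatterjeeMassGapTorusAxialFreeLinkResample
import Summits.QuantumFields.GaugeBoot.DiagonalRPTorusCharacterMoments
import HarnessLib

/-!
# S28ᵀ (Chatterjee torus-axial mass gap) — MERGE and SPLIT with spectators on `ℤᵈ`
(ym-idea-4 g6, LINE-12)

Bears on rung S28ᵀ through the fork `S28BoxBit.gapCore_eventually_of_boxCumulant` (LINE-10),
obligation (O2) `κ_□ ≠ 0` and the evaluation steps of (O1). The one-link Haar identities of
`G ≅ SU(N)` already in the tree (`GaugeBoot.DiagRPSUN`):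

* MERGE `∫_G Re χ(x g⁻¹) Re χ(g y) dg = c₁ Re χ(x y)` (`exists_re_conv_const`: `c₁ = 1/2` for
  `N = 2`, `1/(2N)` for `N ≥ 3`, `c₁ > 0`),
* SPLIT `∫_G Re χ(g x g⁻¹ y) dg = Re(χ(x) χ(y))/N` (`integral_re_trace_conj_mul`),

are lifted here to the infinite lattice: under `dg_∞ = zdHaar d G`, a link `ℓ` shared by two
factors `Re χ(X·U_ℓ⁻¹)`, `Re χ(U_ℓ·W)` (resp. entering one factor twice, `Re χ(U_ℓ X U_ℓ⁻¹ W)`) is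
integrated out in the presence of any continuous spectator `Y` not depending on `ℓ`
(`integral_merge_mul`, `integral_split_mul`), by the one-link resampling identity
`S28FreeLinkResample.integral_mul_eq_integral_integral_update_mul` (LINE-11b). Together with the
free-link absorption of `S28FreeLink` (LINE-11) these are the three moves of the (O2) recipe
`κ_□ = c₁⁹ · N` (nine MERGE steps along a spanning tree of the dual graph of `∂B`, then SPLIT /
absorption; blueprint pub/ideators/ym-idea-4/bc/g6/O1O2-PLAN.md); words are brought to the
`x g⁻¹ / g y` shape by cyclicity of the trace before each step.

No summit is proved here: one-link Haar glue for the island (small-β) case of the S28ᵀ gap core.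
-/

noncomputable section

open MeasureTheory Filter Topology
open Literature.MathematicalPhysics.QuantumLattice
open Literature.MathematicalPhysics.QuantumFieldTheory (zdHaar haarProbability
  IsSpecialUnitaryModel)
open Literature.Probability.LatticeModels (Site)
open Summit.QuantumFields.GaugeBoot (DiagRPSUN.integral_re_trace_conj_mul
  DiagRPSUN.exists_re_conv_const)

namespace Summit.QuantumFields.YangMills.Theorems.S28MergeSplit

open S28FreeLink S28FreeLinkResample

variable {N : ℕ} {G : Type} [Group G] [TopologicalSpace G] [IsTopologicalGroup G]
  [CompactSpace G] [MeasurableSpace G] [BorelSpace G] [SecondCountableTopology G]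
  (ρ : G →* Matrix (Fin N) (Fin N) ℂ)
variable {d : ℕ}

/-- **MERGE with a spectator.** If `∫_G Re χ(x g⁻¹) Re χ(g y) dg = c₁ Re χ(x y)` for all `x, y`
(`DiagRPSUN.exists_re_conv_const` for `G ≅ SU(N)`, `N ≥ 2`), then for continuous `X`, `W`, `Y` not
depending on the link `ℓ`:
`∫ Re χ(X·U_ℓ⁻¹)·Re χ(U_ℓ·W)·Y dg_∞ = c₁ ∫ Re χ(X·W)·Y dg_∞` — two faces sharing `ℓ` merge into one
loop. [folklore] -/
theorem integral_merge_mul (hρ : Continuous ρ) (ℓ : ZdEdge d) {c₁ : ℝ}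
    (hc : ∀ x y : G, ∫ g, ((ρ (x * g⁻¹)).trace).re * ((ρ (g * y)).trace).re ∂haarProbability G =
      c₁ * ((ρ (x * y)).trace).re)
    {X W : LGConfig d G → G} (hXc : Continuous X) (hWc : Continuous W)
    (hX : ∀ (U : LGConfig d G) (g : G), X (Function.update U ℓ g) = X U)
    (hW : ∀ (U : LGConfig d G) (g : G), W (Function.update U ℓ g) = W U)
    {Y : LGConfig d G → ℝ} (hYc : Continuous Y)
    (hY : ∀ (U : LGConfig d G) (g : G), Y (Function.update U ℓ g) = Y U) :
    ∫ U, ((ρ (X U * (U ℓ)⁻¹)).trace).re * ((ρ (U ℓ * W U)).trace).re * Y U ∂zdHaar d G =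
      c₁ * ∫ U, ((ρ (X U * W U)).trace).re * Y U ∂zdHaar d G := by
  have hφ : Continuous fun h : G => ((ρ h).trace).re := Complex.continuous_re.comp hρ.matrix_trace
  have key := integral_mul_eq_integral_integral_update_mul ℓ
    (X := fun U : LGConfig d G => ((ρ (X U * (U ℓ)⁻¹)).trace).re * ((ρ (U ℓ * W U)).trace).re)
    (Y := Y) ((hφ.comp (hXc.mul (continuous_apply ℓ).inv)).mul
      (hφ.comp ((continuous_apply ℓ).mul hWc))) hYc hY
  refine key.trans ?_
  rw [← integral_const_mul]
  refine integral_congr_ae (Eventually.of_forall fun U => ?_)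
  beta_reduce
  simp only [Function.update_self, hX U, hW U]
  rw [hc (X U) (W U), mul_assoc]

/-- **SPLIT with a spectator.** For `G ≅ SU(N)` and continuous `X`, `W`, `Y` not depending on the
link `ℓ`: `∫ Re χ(U_ℓ·X·U_ℓ⁻¹·W)·Y dg_∞ = N⁻¹ ∫ Re(χ(X) χ(W))·Y dg_∞` — a loop through `ℓ` twice
splits into two (`DiagRPSUN.integral_re_trace_conj_mul`). [folklore] -/
theorem integral_split_mul (hρ : IsSpecialUnitaryModel ρ) (ℓ : ZdEdge d)
    {X W : LGConfig d G → G} (hXc : Continuous X) (hWc : Continuous W)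
    (hX : ∀ (U : LGConfig d G) (g : G), X (Function.update U ℓ g) = X U)
    (hW : ∀ (U : LGConfig d G) (g : G), W (Function.update U ℓ g) = W U)
    {Y : LGConfig d G → ℝ} (hYc : Continuous Y)
    (hY : ∀ (U : LGConfig d G) (g : G), Y (Function.update U ℓ g) = Y U) :
    ∫ U, ((ρ (U ℓ * X U * (U ℓ)⁻¹ * W U)).trace).re * Y U ∂zdHaar d G =
      (N : ℝ)⁻¹ * ∫ U, ((ρ (X U)).trace * (ρ (W U)).trace).re * Y U ∂zdHaar d G := by
  have hφ : Continuous fun h : G => ((ρ h).trace).re :=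
    Complex.continuous_re.comp hρ.1.matrix_trace
  have key := integral_mul_eq_integral_integral_update_mul ℓ
    (X := fun U : LGConfig d G => ((ρ (U ℓ * X U * (U ℓ)⁻¹ * W U)).trace).re) (Y := Y)
    (hφ.comp ((((continuous_apply ℓ).mul hXc).mul (continuous_apply ℓ).inv).mul hWc)) hYc hY
  refine key.trans ?_
  rw [← integral_const_mul]
  refine integral_congr_ae (Eventually.of_forall fun U => ?_)
  beta_reduce
  simp only [Function.update_self, hX U, hW U]
  rw [DiagRPSUN.integral_re_trace_conj_mul ρ hρ (X U) (W U), mul_assoc]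

/-- **MERGE with a spectator, `G ≅ SU(N)`, `N ≥ 2`.** The existential-constant form: there is
`c₁ > 0` (`1/2` for `N = 2`, `1/(2N)` for `N ≥ 3`) with
`∫ Re χ(X·U_ℓ⁻¹)·Re χ(U_ℓ·W)·Y dg_∞ = c₁ ∫ Re χ(X·W)·Y dg_∞` for every link `ℓ` and all continuous
`X`, `W`, `Y` not depending on `ℓ`. [folklore] -/
theorem exists_merge_const (hρ : IsSpecialUnitaryModel ρ) (hN : 2 ≤ N) :
    ∃ c₁ : ℝ, 0 < c₁ ∧ ∀ (ℓ : ZdEdge d) (X W : LGConfig d G → G) (Y : LGConfig d G → ℝ),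
      Continuous X → Continuous W → Continuous Y →
      (∀ (U : LGConfig d G) (g : G), X (Function.update U ℓ g) = X U) →
      (∀ (U : LGConfig d G) (g : G), W (Function.update U ℓ g) = W U) →
      (∀ (U : LGConfig d G) (g : G), Y (Function.update U ℓ g) = Y U) →
      ∫ U, ((ρ (X U * (U ℓ)⁻¹)).trace).re * ((ρ (U ℓ * W U)).trace).re * Y U ∂zdHaar d G =
        c₁ * ∫ U, ((ρ (X U * W U)).trace).re * Y U ∂zdHaar d G := by
  obtain ⟨c₁, hc₁, hc⟩ := DiagRPSUN.exists_re_conv_const ρ hρ hN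
  exact ⟨c₁, hc₁, fun ℓ X W Y hXc hWc hYc hX hW hY =>
    integral_merge_mul ρ hρ.1 ℓ hc hXc hWc hX hW hYc hY⟩

/-- **A loop with a free link, any moment.** For continuous `ψ : ℝ → ℝ` (e.g. `ψ t = t²`, the
"`E[tr(loop)²]`" steps of the box computation) and `A`, `B`, `Y` not feeling the shear of `ℓ`:
`∫ ψ(Re χ(A·U_ℓ·B))·Y dg_∞ = (∫_G ψ(Re χ) dg)·∫ Y dg_∞` (`S28FreeLink.integral_mul_eq_of_freeLink`
with `φ = ψ ∘ Re χ`). [folklore] -/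
theorem integral_comp_loop_mul_eq_of_freeLink (hρ : Continuous ρ) (ℓ : ZdEdge d) {ψ : ℝ → ℝ}
    (hψ : Continuous ψ) {A B : LGConfig d G → G} (hAc : Continuous A) (hBc : Continuous B)
    (hA : ∀ (U : LGConfig d G) (g : G),
      A (fun e' => if e' = ℓ then U e' * g else U e') = A U)
    (hB : ∀ (U : LGConfig d G) (g : G),
      B (fun e' => if e' = ℓ then U e' * g else U e') = B U)
    {Y : LGConfig d G → ℝ} (hYc : Continuous Y)
    (hY : ∀ (U : LGConfig d G) (g : G),
      Y (fun e' => if e' = ℓ then U e' * g else U e') = Y U) :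
    ∫ U, ψ ((ρ (A U * U ℓ * B U)).trace).re * Y U ∂zdHaar d G =
      (∫ h, ψ ((ρ h).trace).re ∂haarProbability G) * ∫ U, Y U ∂zdHaar d G :=
  integral_mul_eq_of_freeLink ℓ (φ := fun h : G => ψ ((ρ h).trace).re)
    (hψ.comp (Complex.continuous_re.comp hρ.matrix_trace)) hAc hBc hA hB hYc hY

end Summit.QuantumFields.YangMills.Theorems.S28MergeSplit
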